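import Mathlib
import HarnessLib
import Summits.HubbardSuperconductivity.HubbardSuperconductivity.Theorems.KLProgrammeKLRegimeSplitTwoLegIncrementMomentsFromPosition
import Summits.HubbardSuperconductivity.HubbardSuperconductivity.Theorems.KLProgrammeKLRegimeSplitTwoLegReductionsFn
import Summits.HubbardSuperconductivity.HubbardSuperconductivity.Theorems.KLProgrammeKLRegimeSplitTwoLegPieceFnEval
import Summits.HubbardSuperconductivity.HubbardSuperconductivity.Theorems.KLProgrammePerturbedFermiCurveCompChain
import Summits.HubbardSuperconductivity.HubbardSuperconductivity.Theorems.KLProgrammeKLRegimeCountertermMuFlow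
import Summits.HubbardSuperconductivity.HubbardSuperconductivity.Theorems.KLProgrammeKLRegimeSplitFermiPointC4Regime

/-!
# Route `KLProgramme` — gen-5 ENGINE child, two-leg stubs: (E3a) SIZES of the piece `ℓ_{n+1}(K.eval)` END TO END from the engine's
# POSITION-SPACE increment kernel moments + the frame's C⁴ Fermi-point map (assembly of k3c3-p1's `H_f` calculus, k3c3-p3's composite chain, and
# p1b's Fourier bridge)

Cell `gate-hubbard-kl`, seat p1b (g6).  The (E3a) clause of the (R-I-min) slot (`TwoLegSizesFn … K.eval (n+1)`, tiers `j ≤ 2` / `j ≤ 4`) asks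
`‖Dʲ onM (klTwoLegPieceFn L M β U μ K.eval (n+1)) q‖ ≤ twoLegBar … j (n+1)`.  Three generic layers now in the tree compose into ONE theorem whose
analytic inputs are exactly the engine's natural outputs:

1. **k3c3-p1** `norm_iteratedFDeriv_onM_klTwoLegPieceFn_eval_succ_le` (p483547): the piece's derivatives from sup bounds `G` on
   `Dⁱ(δ − mean δ)`, `i ≤ j`, of the increment PROFILE `δ = ν_{n+1}(K) − ν_n(K)` (+ the cutoff numerals `X`);
2. **k3c3-p3** `abs_iteratedDeriv_comp_le_envelope` (p483894): `|∂ⁱ(F ∘ γ)| ≤ 7·(Σ_{k ≤ i} M_k)·Dⁱ` for `F ∘ γ` with `‖DᵏF‖ ≤ M_k` on the curve and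
   `‖γ⁽ⁱ⁾‖ ≤ Dⁱ` — here `δ = F ∘ γ` with `F = evalM (symInterp L (σ_{n+1} − σ_n))` (the INCREMENT two-leg interpolant, `eval_symInterp_sub`) and
   `γ = toLp ∘ klFermiPoint μ K`;
3. **p1b** `norm_iteratedFDeriv_evalM_symInterp_le_of_moments` (p483280) + `sum_weight_abs_torusCosCoeff_klLocSelfEnergyRe_sub_le` (p486520):
   `M_k ≤ 2·Mˢ_k`, the pinned spatial `k`-th moment of the increment `W^{(n+1)} − W^{(n)}` of the unsectorised position two-leg kernels.

Result **`norm_iteratedFDeriv_onM_pieceFn_eval_succ_le_of_position_moments`**: for a frame of `C²` size `A` (`2A < Dt_min`, window), `μ ∈ klWindowC`,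
a `C⁴` Fermi-point map with `‖γ⁽ⁱ⁾‖ ≤ Dⁱ` (`fermiPointLp_C4_of_frameOK`, p473243), increment moments `Mˢ_k` (`k ≤ 4`) and cutoff numerals `X`:
`‖Dʲ onM ℓ_{n+1}(K.eval)(q)‖ ≤ [j = 0]·2Mˢ₀ + (j!)²(2·j!·X·200ʲ)·G·(4 + max 1 ((j−1)!/(8/5)))ʲ` with the EXPLICIT
`G = 4Mˢ₀ + 14·(Σ_{k=1}^{4} Mˢ_k)·(max D 1)⁴` — the stub prover's remaining duty for (E3a) of `ℓ_{n+1}` is the fit of this number into `twoLegBar`.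
§Regime (appended): the same keyed by `FrameOK R U (nScales β) μ K` in the KL regime (`norm_iteratedFDeriv_onM_pieceFn_eval_succ_le_of_frameOK_regime`),
the curve constant from `fermiPointLp_C4_of_frameOK`.
Everything is PROVED; no definitions; nothing about the model is asserted.  References: BGM 2006 (2.36) [cite: BenfattoGiulianiMastropietro2006].
-/

noncomputable section

namespace Summit.HubbardSuperconductivity.HubbardSuperconductivity.Theorems.KLRegimeSplit

set_option linter.dupNamespace false -- summit = problem name (single-conjunct summit), D-0017

open Real Finset
open Literature.MathematicalPhysics.QuantumLattice Literature.MathematicalPhysics.QuantumLattice.BandSectorCounting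
open Literature.Probability.LatticeModels
open Summit.HubbardSuperconductivity.HubbardSuperconductivity.Theorems.DispersionFlow
open Summit.HubbardSuperconductivity.HubbardSuperconductivity.Theorems.PerturbedFermiCurve
open Summit.HubbardSuperconductivity.HubbardSuperconductivity.Theorems.KLProgrammeLegKernels
open Summit.HubbardSuperconductivity.HubbardSuperconductivity.Theorems.TwoLegFourier

section Model

variable {L M : ℕ} [NeZero L] [NeZero M]

/-- **The increment profile is the increment interpolant read along the Fermi-point map**:
`ν_{n+1}(K)(θ) − ν_n(K)(θ) = evalM (symInterp L (σ_{n+1} − σ_n)) (toLp (k_F^K θ))`. -/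
theorem klLocalPart_sub_eq_comp (β U μ : ℝ) (K : TrigPolyC4v) (n : ℕ) :
    (fun θ => klLocalPart L M β U μ K (n + 1) θ - klLocalPart L M β U μ K n θ) =
      evalM (symInterp L fun k => klLocSelfEnergyRe L M β U μ K (n + 1) k - klLocSelfEnergyRe L M β U μ K n k) ∘
        fun θ => (WithLp.toLp 2 (klFermiPoint μ K θ) : Momentum) := by
  funext θ
  simp only [Function.comp_apply, evalM_apply, klLocalPart, eval_symInterp_sub]

variable {a b : ℝ} (B : BandBounds a b) {K : TrigPolyC4v} {A : ℝ}
  (hA : ∀ p : Momentum, ∀ j ≤ 2, ‖iteratedFDeriv ℝ j (frameShift K) p‖ ≤ A) (hADt : 2 * A < B.Dtmin)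
  {μ : ℝ} (hlo : a ≤ μ - A) (hhi : μ + A ≤ b)
include B hA hADt hlo hhi

/-- **(E3a) SIZES OF `ℓ_{n+1}(K.eval)` END TO END FROM POSITION-SPACE INCREMENT MOMENTS AND THE CURVE.**  Frame of `C²` size `A`
(`2A < Dt_min`, `[μ − A, μ + A] ⊂ [a, b]`), `μ ∈ klWindowC`; `β > 0`; the Fermi-point map `γ = toLp ∘ klFermiPoint μ K` of class `C⁴` with
`‖γ⁽ⁱ⁾‖ ≤ Dⁱ` (`1 ≤ i ≤ 4`); the increment `W_σ^{(n+1)} − W_σ^{(n)}` of the unsectorised position two-leg kernels with pinned spatial `k`-th moments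
`≤ Mˢ k` (`k ≤ 4`, both spins); cutoff numerals `‖χ₂⁽ˡ⁾‖ ≤ X` (`l ≤ j`).  Then for every `j ≤ 4` and momentum `q`,
`‖Dʲ onM (klTwoLegPieceFn L M β U μ K.eval (n+1)) q‖ ≤ [j=0]·2Mˢ₀ + (j!)²·(2·j!·X·200ʲ)·G·(4 + max 1 ((j−1)!/(8/5)))ʲ`,
`G = 4·Mˢ 0 + 14·(Σ_{k ∈ Icc 1 4} Mˢ k)·(max D 1)⁴`. [cite: BenfattoGiulianiMastropietro2006, (2.36)] -/
theorem norm_iteratedFDeriv_onM_pieceFn_eval_succ_le_of_position_moments {β U : ℝ} (hβ : 0 < β) (hμ : μ ∈ klWindowC) {n : ℕ}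
    {Ms : ℕ → ℝ}
    (hMs : ∀ k ≤ 4, ∀ (σ : Fin 2) (x₀ : SpaceTimeIdx L M), imagTimeWeight β M *
      ∑ x ∈ (univ : Finset (Fin 2 → SpaceTimeIdx L M)).filter (fun x => x 0 = x₀),
        (1 + ((((x 1).2 - (x 0).2) 0).valMinAbs.natAbs : ℝ) + ((((x 1).2 - (x 0).2) 1).valMinAbs.natAbs : ℝ)) ^ k *
          ‖sectorisedKernel L M β (trivialMultiplier L M) (klEffectiveAction L M β U μ K klE0 (n + 1)) 2
              (![((0, σ), 0), ((0, σ), 1)] : Fin 2 → SectorLeg 1) x -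
            sectorisedKernel L M β (trivialMultiplier L M) (klEffectiveAction L M β U μ K klE0 n) 2
              (![((0, σ), 0), ((0, σ), 1)] : Fin 2 → SectorLeg 1) x‖ ≤ Ms k)
    {D : ℝ} (hγ : ContDiff ℝ 4 fun θ => (WithLp.toLp 2 (klFermiPoint μ K θ) : Momentum))
    (hD : ∀ i, 1 ≤ i → i ≤ 4 → ∀ θ : ℝ, ‖iteratedDeriv i (fun θ => (WithLp.toLp 2 (klFermiPoint μ K θ) : Momentum)) θ‖ ≤ D ^ i)
    {j : ℕ} (hj : j ≤ 4) {X : ℝ} (hX : ∀ l ≤ j, ∀ x : ℝ, ‖iteratedFDeriv ℝ l salmhoferCutoff x‖ ≤ X) (q : Momentum) :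
    ‖iteratedFDeriv ℝ j (onM (klTwoLegPieceFn L M β U μ K.eval (n + 1))) q‖ ≤
      (if j = 0 then 2 * Ms 0 else 0) +
        (j.factorial : ℝ) ^ 2 * (2 * j.factorial * X * 200 ^ j) *
          (4 * Ms 0 + 14 * (∑ k ∈ Icc 1 4, Ms k) * (max D 1) ^ 4) * (4 + max 1 (((j - 1).factorial : ℝ) / (8 / 5))) ^ j := by
  -- the increment interpolant and the profile
  set F : Momentum → ℝ :=
    evalM (symInterp L fun k => klLocSelfEnergyRe L M β U μ K (n + 1) k - klLocSelfEnergyRe L M β U μ K n k) with hF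
  set γ : ℝ → Momentum := fun θ => (WithLp.toLp 2 (klFermiPoint μ K θ) : Momentum) with hγdef
  set δ : ℝ → ℝ := fun θ => klLocalPart L M β U μ K (n + 1) θ - klLocalPart L M β U μ K n θ with hδ
  have hδF : δ = F ∘ γ := klLocalPart_sub_eq_comp β U μ K n
  -- moments ⇒ sup bounds of `Dᵏ F` everywhere
  have hMk : ∀ k ≤ 4, ∀ p : Momentum, ‖iteratedFDeriv ℝ k F p‖ ≤ 2 * Ms k := fun k hk p =>
    norm_iteratedFDeriv_evalM_symInterp_le_of_moments (sum_weight_abs_torusCosCoeff_klLocSelfEnergyRe_sub_le hβ U μ K n k (hMs k hk)) p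
  have hMs0 : ∀ k ≤ 4, 0 ≤ Ms k := fun k hk => by
    have := hMk k hk q; linarith [norm_nonneg (iteratedFDeriv ℝ k F q)]
  have hD0 : 0 ≤ D := (norm_nonneg _).trans (by simpa using hD 1 le_rfl (by norm_num) 0)
  -- the composite bounds of `δ = F ∘ γ` (orders 1…4) and the value bound (order 0)
  have hFc : ContDiff ℝ 4 F := contDiff_evalM _
  have hval : ∀ θ, |δ θ| ≤ 2 * Ms 0 := fun θ => by
    rw [hδF, Function.comp_apply, ← Real.norm_eq_abs, ← norm_iteratedFDeriv_zero (𝕜 := ℝ)]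
    exact hMk 0 (by norm_num) _
  have hder : ∀ i, 1 ≤ i → i ≤ 4 → ∀ θ, |iteratedDeriv i δ θ| ≤ 7 * (∑ k ∈ Icc 1 i, 2 * Ms k) * D ^ i := fun i hi1 hi4 θ => by
    rw [hδF]
    exact abs_iteratedDeriv_comp_le_envelope hFc hγ (fun k hk1 hk4 => hMk k hk4 _) (fun i hi1 hi4 => hD i hi1 hi4 θ) hi1 hi4
  -- the mean
  have hmean : |klAngularMean δ| ≤ 2 * Ms 0 := abs_klAngularMean_le' hval
  -- the `G` of the `H_f` calculus
  set G : ℝ := 4 * Ms 0 + 14 * (∑ k ∈ Icc 1 4, Ms k) * (max D 1) ^ 4 with hGdef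
  have hsum4 : 0 ≤ ∑ k ∈ Icc 1 4, Ms k := sum_nonneg fun k hk => hMs0 k (mem_Icc.1 hk).2
  have hDm : D ≤ max D 1 := le_max_left _ _
  have h1m : 1 ≤ max D 1 := le_max_right _ _
  have hG : ∀ i ≤ j, ∀ t : ℝ, ‖iteratedFDeriv ℝ i (fun t => δ t - klAngularMean δ) t‖ ≤ G := by
    intro i hi t
    have hi4 : i ≤ 4 := hi.trans hj
    rcases Nat.eq_zero_or_pos i with rfl | hipos
    · rw [norm_iteratedFDeriv_zero, Real.norm_eq_abs]
      have h := abs_sub (δ t) (klAngularMean δ)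
      have hv := hval t
      have : 0 ≤ 14 * (∑ k ∈ Icc 1 4, Ms k) * (max D 1) ^ 4 := by positivity
      linarith
    · -- `i ≥ 1`: the constant drops, the composite bound applies
      have hδc : ContDiff ℝ 4 δ := by rw [hδF]; exact hFc.comp hγ
      have hsub : iteratedFDeriv ℝ i (fun t => δ t - klAngularMean δ) t = iteratedFDeriv ℝ i δ t := by
        rw [fun_iteratedFDeriv_sub_apply (hδc.contDiffAt.of_le (by exact_mod_cast hi4)) contDiffAt_const,
          iteratedFDeriv_const_of_ne (Nat.pos_iff_ne_zero.1 hipos), Pi.zero_apply, sub_zero]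
      rw [hsub, norm_iteratedFDeriv_eq_norm_iteratedDeriv, Real.norm_eq_abs]
      refine (hder i hipos hi4 t).trans ?_
      -- `7·(Σ_{k ≤ i} 2 Ms_k)·D^i ≤ 14·(Σ_{k ≤ 4} Ms_k)·(max D 1)^4 ≤ G`
      have hsub_sum : ∑ k ∈ Icc 1 i, 2 * Ms k ≤ 2 * ∑ k ∈ Icc 1 4, Ms k := by
        rw [mul_sum]
        exact sum_le_sum_of_subset_of_nonneg (Icc_subset_Icc le_rfl hi4) fun k hk _ => by
          have := hMs0 k (mem_Icc.1 hk).2; linarith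
      have hDi : D ^ i ≤ (max D 1) ^ 4 :=
        (pow_le_pow_left₀ hD0 hDm i).trans (pow_le_pow_right₀ h1m hi4)
      have h7 : 7 * (∑ k ∈ Icc 1 i, 2 * Ms k) * D ^ i ≤ 14 * (∑ k ∈ Icc 1 4, Ms k) * (max D 1) ^ 4 := by
        have h0 : 0 ≤ ∑ k ∈ Icc 1 i, 2 * Ms k := sum_nonneg fun k hk => by have := hMs0 k ((mem_Icc.1 hk).2.trans hi4); linarith
        calc 7 * (∑ k ∈ Icc 1 i, 2 * Ms k) * D ^ i ≤ 7 * (2 * ∑ k ∈ Icc 1 4, Ms k) * D ^ i := by gcongr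
          _ ≤ 7 * (2 * ∑ k ∈ Icc 1 4, Ms k) * (max D 1) ^ 4 := by gcongr
          _ = 14 * (∑ k ∈ Icc 1 4, Ms k) * (max D 1) ^ 4 := by ring
      have : 0 ≤ 4 * Ms 0 := by have := hMs0 0 (by norm_num); linarith
      linarith
  -- smoothness of the two local parts (frame hypotheses) and the `H_f` calculus
  have h₁ : ContDiff ℝ 4 (klLocalPart L M β U μ K (n + 1)) := contDiff_klLocalPart B hA hADt hlo hhi L M β U (n + 1)
  have h₀ : ContDiff ℝ 4 (klLocalPart L M β U μ K n) := contDiff_klLocalPart B hA hADt hlo hhi L M β U n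
  have hmain := norm_iteratedFDeriv_onM_klTwoLegPieceFn_eval_succ_le (L := L) (M := M) K n (N := 4) h₁ h₀
    (j := j) (by exact_mod_cast hj) hμ hG hX q
  refine hmain.trans (add_le_add ?_ le_rfl)
  split_ifs
  · exact hmean
  · exact le_rfl

end Model

section Regime

variable {L M : ℕ} [NeZero L] [NeZero M]

/-- **(E3a) sizes of `ℓ_{n+1}(K.eval)` FOR EVERY ADMISSIBLE FRAME IN THE KL REGIME, from position-space increment moments alone.**  For every `R`
(`Gfr ≥ 0`) there are `c₃, U₀ > 0` and, for `0 < c ≤ c₃`, `0 < U ≤ U₀`, `klBetaMin ≤ β ≤ e^{c/U²}`, a curve constant `D ≥ 1` (frame- and volume-free)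
such that for `μ ∈ klWindowC`, every `K` with `FrameOK R U (nScales β) μ K`, all volumes, scales `n`, increment moments `Mˢ k` (`k ≤ 4`, pinned spatial
moments of `W^{(n+1)} − W^{(n)}`), `j ≤ 4` and cutoff numerals `X`: `‖Dʲ onM (klTwoLegPieceFn … K.eval (n+1)) q‖ ≤` the explicit bound of
`norm_iteratedFDeriv_onM_pieceFn_eval_succ_le_of_position_moments` (the Fermi-point map's `C⁴` bounds come from `fermiPointLp_C4_of_frameOK`). -/
theorem norm_iteratedFDeriv_onM_pieceFn_eval_succ_le_of_frameOK_regime (R : RenConsts) (hR : ∀ j, 0 ≤ R.Gfr j) :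
    ∃ c₃ : ℝ, 0 < c₃ ∧ ∃ U₀ : ℝ, 0 < U₀ ∧
      ∀ c : ℝ, 0 < c → c ≤ c₃ → ∀ U : ℝ, 0 < U → U ≤ U₀ → ∀ β : ℝ, klBetaMin ≤ β → β ≤ Real.exp (c / U ^ 2) →
      ∃ D : ℝ, 1 ≤ D ∧ ∀ μ ∈ klWindowC, ∀ K : TrigPolyC4v, FrameOK R U (nScales β) μ K →
        ∀ (L M : ℕ) [NeZero L] [NeZero M] (n : ℕ) (Ms : ℕ → ℝ),
          (∀ k ≤ 4, ∀ (σ : Fin 2) (x₀ : SpaceTimeIdx L M), imagTimeWeight β M *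
            ∑ x ∈ (univ : Finset (Fin 2 → SpaceTimeIdx L M)).filter (fun x => x 0 = x₀),
              (1 + ((((x 1).2 - (x 0).2) 0).valMinAbs.natAbs : ℝ) + ((((x 1).2 - (x 0).2) 1).valMinAbs.natAbs : ℝ)) ^ k *
                ‖sectorisedKernel L M β (trivialMultiplier L M) (klEffectiveAction L M β U μ K klE0 (n + 1)) 2
                    (![((0, σ), 0), ((0, σ), 1)] : Fin 2 → SectorLeg 1) x -
                  sectorisedKernel L M β (trivialMultiplier L M) (klEffectiveAction L M β U μ K klE0 n) 2
                    (![((0, σ), 0), ((0, σ), 1)] : Fin 2 → SectorLeg 1) x‖ ≤ Ms k) →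
          ∀ (j : ℕ), j ≤ 4 → ∀ (X : ℝ), (∀ l ≤ j, ∀ x : ℝ, ‖iteratedFDeriv ℝ l salmhoferCutoff x‖ ≤ X) → ∀ q : Momentum,
            ‖iteratedFDeriv ℝ j (onM (klTwoLegPieceFn L M β U μ K.eval (n + 1))) q‖ ≤
              (if j = 0 then 2 * Ms 0 else 0) +
                (j.factorial : ℝ) ^ 2 * (2 * j.factorial * X * 200 ^ j) *
                  (4 * Ms 0 + 14 * (∑ k ∈ Icc 1 4, Ms k) * (max D 1) ^ 4) * (4 + max 1 (((j - 1).factorial : ℝ) / (8 / 5))) ^ j := by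
  have ha : (-4 : ℝ) < -1.1 := by norm_num
  have hab : (-1.1 : ℝ) ≤ -0.1 := by norm_num
  have hb : (-0.1 : ℝ) < 0 := by norm_num
  set B := bandBounds ha hab hb with hBdef
  have hDt := B.Dtmin_pos
  set κ : ℝ := min B.Dtmin (1 / 5) with hκdef
  have hκ : 0 < κ := lt_min hDt (by norm_num)
  obtain ⟨c₁, hc₁, U₁, hU₁, hthr⟩ := frame_thresholds hR hκ
  obtain ⟨c₂, hc₂, U₂, hU₂, hcurve⟩ := fermiPointLp_C4_of_frameOK R hR
  refine ⟨min c₁ c₂, lt_min hc₁ hc₂, min U₁ U₂, lt_min hU₁ hU₂, ?_⟩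
  intro c hc hcle U hU hUle β hβmin hβc
  obtain ⟨D, hD1, hD⟩ := hcurve c hc (hcle.trans (min_le_right _ _)) U hU (hUle.trans (min_le_right _ _)) β hβmin hβc
  refine ⟨D, hD1, ?_⟩
  intro μ hμ K hK L M _ _ n Ms hMs j hj X hX q
  have hβ : 0 < β := lt_of_lt_of_le (by unfold klBetaMin; norm_num) hβmin
  have hAf : ∀ p : Momentum, ∀ j ≤ 2, ‖iteratedFDeriv ℝ j (frameShift K) p‖ ≤
      2 * R.Gfr 0 * |U| + 2 * R.Gfr 1 * U ^ 2 + R.Gfr 2 * (c / Real.log 4) := fun p j hj =>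
    norm_iteratedFDeriv_frameShift_le_of_frameOK_regime hR hc.le hβmin hβc hK p hj
  set A := 2 * R.Gfr 0 * |U| + 2 * R.Gfr 1 * U ^ 2 + R.Gfr 2 * (c / Real.log 4) with hAdef
  have h4A : 4 * A ≤ κ := hthr c U hc.le (hcle.trans (min_le_left _ _)) hU (hUle.trans (min_le_left _ _))
  have hA0 : 0 ≤ A := le_trans (norm_nonneg _) (hAf 0 0 (by norm_num))
  have hκDt : κ ≤ B.Dtmin := min_le_left _ _
  have hκ5 : κ ≤ 1 / 5 := min_le_right _ _
  have hADt : 2 * A < B.Dtmin := by linarith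
  have hA20 : A ≤ 1 / 20 := by linarith
  obtain ⟨hlo, hhi⟩ := klWindowC_margin hμ hA20
  obtain ⟨hγ, hDer⟩ := hD μ hμ K hK
  exact norm_iteratedFDeriv_onM_pieceFn_eval_succ_le_of_position_moments B hAf hADt hlo hhi hβ hμ hMs hγ hDer hj hX q

end Regime

end Summit.HubbardSuperconductivity.HubbardSuperconductivity.Theorems.KLRegimeSplit

end
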